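import Summits.BirchSwinnertonDyer.BirchSwinnertonDyer.Theorems.ThetaPartnerAtTwoSignedKatoUpToAtTwoKatoBKSocketKZUHelpers
import HarnessLib

/-!
# Route `ThetaPartnerAtTwo` (TP2), crux K3 `SignedKatoDivisibilityUpToAtTwo` (stmt-BirchSwinnertonDyer-20308 / K3P′ 25631), line `colemanrat`
# v13 — CORE_KZ ⟹ CORE_KZ˟: the unit-tolerant residue is WEAKER still (take `u := 1`)

Width seat `bsd-wall-tp2-p2x-w3` g8 (cell `bsd-wall`). CORE_KZ = hypothesis of `KatoBK.corePairChiPrim_of_coreKZ_of_bricks` (p636266);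
CORE_KZ˟ = hypothesis of `KatoBK.corePairChiPrim_of_coreKZU_of_bricks` (`…KatoBKSocketKZU.lean`): the layer-pairing identity for Kato's
displayed classes only UP TO a non-zero rational constant `u`. Chain of record: CORE_KBK_std ⟹ CORE_KZ (`coreKZ_of_coreKBKStd`, p636379)
⟹ CORE_KZ˟ (here) ⟹ CORE_pairχ^prim ⟹ … ⟹ K3P′. HONEST FRAMING: one implication between displayed hypotheses (no definition, no named
fact, no instance, no `sorry`); closes no item; K3 / K3P′ NOT settled; BSD is NOT proved by any of this.
-/

set_option autoImplicit false
-- the Theorems namespace of this sub repeats the summit name by design (D-0017 nested layout)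
set_option linter.dupNamespace false
noncomputable section
set_option backward.isDefEq.respectTransparency false

open scoped Classical MatrixGroups ModularForm NumberField TensorProduct

open CongruenceSubgroup WeierstrassCurve Field IsDedekindDomain NumberField
  Literature.NumberTheory.GaloisRepresentations
  Literature.NumberTheory.EllipticCurves Literature.NumberTheory.EllipticCurves.ModularForms
  Literature.NumberTheory.EllipticCurves.Module Literature.NumberTheory.EllipticCurves.Rank1Residual
  Literature.NumberTheory.EllipticCurves.Kobayashi2003 Literature.NumberTheory.EllipticCurves.Kato2004
  Literature.NumberTheory.EllipticCurves.Kato2004.EulerSystemValues Literature.NumberTheory.EllipticCurves.GreenbergSelmer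
  Literature.NumberTheory.EllipticCurves.Sprung2012
  Literature.NumberTheory.EllipticCurves.FormalGroupChart
  ZpExtension Summit.BirchSwinnertonDyer.Rank1Residual.Supersingular
  Summit.BirchSwinnertonDyer.Rank1Residual.Additive Summit.BirchSwinnertonDyer.Rank1Residual.Additive.PadicCyclotomicTower
  Summit.BirchSwinnertonDyer.Rank1Residual.Additive.BallEval
  Summit.BirchSwinnertonDyer.BirchSwinnertonDyer.Theorems.SignedKatoOffTwo.LocalTwo
namespace Summit.BirchSwinnertonDyer.BirchSwinnertonDyer.Theorems.SignedKatoOffTwo.KatoBK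

/-- **CORE_KZ ⟹ CORE_KZ˟** (`u := 1`). [cite: Kato2004Asterisque, Thm. 12.5 (1) (pp. 221–222)] [cite: BlochKato1990, §3 (3.10.1), (3.11.1)] -/
theorem coreKZU_of_coreKZ
    (hKZ :
      ∀ (v : HeightOneSpectrum (𝓞 ℚ)), ((2 : ℕ) : 𝓞 ℚ) ∈ v.asIdeal →
      ∀ (W : WeierstrassCurve ℚ) [W.IsElliptic] [W.IsGloballyMinimal],
        ¬ W.HasCM → W.analyticRank = 0 → GoodSS W 2 → W.frobeniusTrace 2 = 0 →
        ∀ (κ : ZpExtension ℚ 2) (γ : Field.absoluteGaloisGroup ℚ) (hκ : κ.IsCyclotomic),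
          κ.IsTopGenerator γ → IsCyclotomicVariable 2 γ →
          ∀ [NeZero (W.conductorNorm ℤ)] (f : CuspForm (Gamma0 (W.conductorNorm ℤ)) 2),
            IsNewformOf W f → ∀ (ϖ : ℚ), (ϖ : ℝ) * W.realPeriodRat = plusPeriod f →
          ∀ (Lplus Lminus : IwasawaAlgebra 2), IsPollackPair f 2 Lplus Lminus →
          ∀ [ContinuousSMul ℤ_[2] (W.tateModule 2)] [Module.Free ℤ_[2] (W.tateModule 2)]
            [Module.Finite ℤ_[2] (W.tateModule 2)],
          ∀ (pair : ∀ n : ℕ, H1 (tateRep W 2) (κ.layerSubgroup n) →ₗ[ℤ_[2]]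
              (localLayerPointsOfEmb κ (closureEmb (K := ℚ) (v.adicCompletion ℚ)) W n →+ ℤ_[2])),
            (∀ (n : ℕ) (x : H1 (tateRep W 2) (κ.layerSubgroup (n + 1))) (Q : localPoints W (v.adicCompletion ℚ))
              (hQ : Q ∈ localLayerPointsOfEmb κ (closureEmb (K := ℚ) (v.adicCompletion ℚ)) W n),
              pair n (layerCores (tateRep W 2) κ n x) ⟨Q, hQ⟩ =
                pair (n + 1) x ⟨Q, localLayerPointsOfEmb_mono κ (closureEmb (K := ℚ) (v.adicCompletion ℚ)) W (Nat.le_succ n) hQ⟩) →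
            (∀ (n : ℕ) (g : absoluteGaloisGroup (v.adicCompletion ℚ)) (y : H1 (tateRep W 2) (κ.layerSubgroup n))
              (Q : localPoints W (v.adicCompletion ℚ))
              (hQ : Q ∈ localLayerPointsOfEmb κ (closureEmb (K := ℚ) (v.adicCompletion ℚ)) W n),
              pair n (conjMap (tateRep W 2).toTopRep (κ.layerSubgroup n) (resGalOfEmb (closureEmb (K := ℚ) (v.adicCompletion ℚ)) g) 1 y)
                ⟨g • Q, smul_mem_localLayerPointsOfEmb κ (closureEmb (K := ℚ) (v.adicCompletion ℚ)) W n g hQ⟩ = pair n y ⟨Q, hQ⟩) →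
            (∀ (n k : ℕ) (x : H1 (tateRep W 2) (κ.layerSubgroup n))
              (Q : localLayerPointsOfEmb κ (closureEmb (K := ℚ) (v.adicCompletion ℚ)) W n),
              PadicInt.toZModPow k (pair n x Q) =
                LayerPairing.layerPairingPk W κ v (LayerPairing.weilTowerPk W) (LayerPairing.weilTowerPk_pow W)
                  (LayerPairing.weilTowerPk_add_left W) (LayerPairing.weilTowerPk_add_right W) (LayerPairing.weilTowerPk_smul W)
                  n k x Q) →
          ∀ (Φ : AlgebraicClosure ℚ_[2] ≃ₐ[ℚ] AlgebraicClosure (v.adicCompletion ℚ)) (φ : ℚ_[2] ≃+* v.adicCompletion ℚ),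
            (∀ y : ℚ_[2], Φ (algebraMap ℚ_[2] (AlgebraicClosure ℚ_[2]) y) =
              algebraMap (v.adicCompletion ℚ) (AlgebraicClosure (v.adicCompletion ℚ)) (φ y)) →
          ∀ (ι : AlgebraicClosure ℚ →ₐ[ℚ] AlgebraicClosure ℚ_[2]),
            (∀ z, closureEmb (K := ℚ) (v.adicCompletion ℚ) z = Φ (ι z)) →
          ∀ (e : ∀ k : ℕ, CyclotomicField (cycLevel 2 k ∅) ℚ →ₐ[ℚ] PadicAlgCl 2),
            (∀ k, e k (IsCyclotomicExtension.zeta (cycLevel 2 k ∅) ℚ (CyclotomicField (cycLevel 2 k ∅) ℚ)) = zeta 2 k) →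
          ∀ (τ : ∀ m : ℕ, ZMod (2 ^ m) → Field.absoluteGaloisGroup ℚ_[2]),
            (∀ (m : ℕ) (a : ZMod (2 ^ m)), IsUnit a → τ m a • zeta 2 m = zeta 2 m ^ a.val) →
          ∀ (ιC : (m : ℕ) → (CyclotomicField m ℚ →+* ℂ)),
          (∀ k : ℕ, ιC (cycLevel 2 k ∅) (IsCyclotomicExtension.zeta (cycLevel 2 k ∅) ℚ (CyclotomicField (cycLevel 2 k ∅) ℚ)) =
            Complex.exp (2 * Real.pi * Complex.I / (cycLevel 2 k ∅ : ℕ))) →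
          ∃ κK : ℝ, κK ≠ 0 ∧
          ∃ ΛK : ∀ (k : ℕ) (r : Finset (HeightOneSpectrum (𝓞 ℚ))),
              H1 (tateRep W 2) (cycSubgroup 2 k r) →ₗ[ℤ_[2]] ℚ_[2] ⊗[ℚ] CyclotomicField (cycLevel 2 k r) ℚ,
            ∀ (c d a : ℤ) (A : ℕ), 0 < A → Int.gcd c (6 * 2 * A) = 1 → Int.gcd d (6 * 2 * W.conductorNorm ℤ) = 1 →
              ∃ (z : ∀ (k : ℕ) (r : (cyclotomicLevelsRat 2 (badPlaces c d A (W.conductorNorm ℤ))).Ideals),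
                    H1 (tateRep W 2) ((cyclotomicLevelsRat 2 (badPlaces c d A (W.conductorNorm ℤ))).level k r.1))
                (x : ∀ (k : ℕ) (r : (cyclotomicLevelsRat 2 (badPlaces c d A (W.conductorNorm ℤ))).Ideals),
                    CyclotomicField (cycLevel 2 k r.1) ℚ),
                ZetaBody W 2 f ιC κK ΛK c d a A z x ∧
                (haveI := isIntegral_genFib_baseChange 2 ((integralModelInt W).map (Int.castRingHom ℤ_[2]))
                 ∀ (n : ℕ) (Q₀ : localPoints W ℚ_[2])
                  (hQv : WeierstrassCurve.Affine.Point.map (W' := W)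
                      (Φ : AlgebraicClosure ℚ_[2] →ₐ[ℚ] AlgebraicClosure (v.adicCompletion ℚ))
                      (show (W.baseChange (AlgebraicClosure ℚ_[2])).toAffine.Point from Q₀) ∈
                    localLayerPointsOfEmb κ (closureEmb (K := ℚ) (v.adicCompletion ℚ)) W n),
                  (toLoc ((genFibΩ_eq_baseChange ((integralModelInt W).map (Int.castRingHom ℤ_[2]))).trans
                    (baseChange_twoAdicModel W))).symm Q₀ ∈
                    kernel (Valued.v (R := PadicAlgCl 2)) (genFibΩ 2 ((integralModelInt W).map (Int.castRingHom ℤ_[2]))) →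
                  algebraMap ℚ_[2] (PadicAlgCl 2)
                      ((pair n (levelToLayerTwo W hκ (∅ : Set (HeightOneSpectrum (𝓞 ℚ))) n
                          (z (n + 2) (cyclotomicLevelsRat 2 (badPlaces c d A (W.conductorNorm ℤ))).idealOne))
                        ⟨_, hQv⟩ : ℤ_[2]) : ℚ_[2]) =
                    ∑ b : (ZMod (2 ^ (n + 2)))ˣ, τ (n + 2) (b : ZMod (2 ^ (n + 2))) •
                      (ptLogΩ 2 ((integralModelInt W).map (Int.castRingHom ℤ_[2]))
                          ((toLoc ((genFibΩ_eq_baseChange ((integralModelInt W).map (Int.castRingHom ℤ_[2]))).trans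
                            (baseChange_twoAdicModel W))).symm Q₀) *
                        e (n + 2) (x (n + 2) (cyclotomicLevelsRat 2 (badPlaces c d A (W.conductorNorm ℤ))).idealOne)))) :
      ∀ (v : HeightOneSpectrum (𝓞 ℚ)), ((2 : ℕ) : 𝓞 ℚ) ∈ v.asIdeal →
      ∀ (W : WeierstrassCurve ℚ) [W.IsElliptic] [W.IsGloballyMinimal],
        ¬ W.HasCM → W.analyticRank = 0 → GoodSS W 2 → W.frobeniusTrace 2 = 0 →
        ∀ (κ : ZpExtension ℚ 2) (γ : Field.absoluteGaloisGroup ℚ) (hκ : κ.IsCyclotomic),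
          κ.IsTopGenerator γ → IsCyclotomicVariable 2 γ →
          ∀ [NeZero (W.conductorNorm ℤ)] (f : CuspForm (Gamma0 (W.conductorNorm ℤ)) 2),
            IsNewformOf W f → ∀ (ϖ : ℚ), (ϖ : ℝ) * W.realPeriodRat = plusPeriod f →
          ∀ (Lplus Lminus : IwasawaAlgebra 2), IsPollackPair f 2 Lplus Lminus →
          ∀ [ContinuousSMul ℤ_[2] (W.tateModule 2)] [Module.Free ℤ_[2] (W.tateModule 2)]
            [Module.Finite ℤ_[2] (W.tateModule 2)],
          ∀ (pair : ∀ n : ℕ, H1 (tateRep W 2) (κ.layerSubgroup n) →ₗ[ℤ_[2]]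
              (localLayerPointsOfEmb κ (closureEmb (K := ℚ) (v.adicCompletion ℚ)) W n →+ ℤ_[2])),
            (∀ (n : ℕ) (x : H1 (tateRep W 2) (κ.layerSubgroup (n + 1))) (Q : localPoints W (v.adicCompletion ℚ))
              (hQ : Q ∈ localLayerPointsOfEmb κ (closureEmb (K := ℚ) (v.adicCompletion ℚ)) W n),
              pair n (layerCores (tateRep W 2) κ n x) ⟨Q, hQ⟩ =
                pair (n + 1) x ⟨Q, localLayerPointsOfEmb_mono κ (closureEmb (K := ℚ) (v.adicCompletion ℚ)) W (Nat.le_succ n) hQ⟩) →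
            (∀ (n : ℕ) (g : absoluteGaloisGroup (v.adicCompletion ℚ)) (y : H1 (tateRep W 2) (κ.layerSubgroup n))
              (Q : localPoints W (v.adicCompletion ℚ))
              (hQ : Q ∈ localLayerPointsOfEmb κ (closureEmb (K := ℚ) (v.adicCompletion ℚ)) W n),
              pair n (conjMap (tateRep W 2).toTopRep (κ.layerSubgroup n) (resGalOfEmb (closureEmb (K := ℚ) (v.adicCompletion ℚ)) g) 1 y)
                ⟨g • Q, smul_mem_localLayerPointsOfEmb κ (closureEmb (K := ℚ) (v.adicCompletion ℚ)) W n g hQ⟩ = pair n y ⟨Q, hQ⟩) →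
            (∀ (n k : ℕ) (x : H1 (tateRep W 2) (κ.layerSubgroup n))
              (Q : localLayerPointsOfEmb κ (closureEmb (K := ℚ) (v.adicCompletion ℚ)) W n),
              PadicInt.toZModPow k (pair n x Q) =
                LayerPairing.layerPairingPk W κ v (LayerPairing.weilTowerPk W) (LayerPairing.weilTowerPk_pow W)
                  (LayerPairing.weilTowerPk_add_left W) (LayerPairing.weilTowerPk_add_right W) (LayerPairing.weilTowerPk_smul W)
                  n k x Q) →
          ∀ (Φ : AlgebraicClosure ℚ_[2] ≃ₐ[ℚ] AlgebraicClosure (v.adicCompletion ℚ)) (φ : ℚ_[2] ≃+* v.adicCompletion ℚ),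
            (∀ y : ℚ_[2], Φ (algebraMap ℚ_[2] (AlgebraicClosure ℚ_[2]) y) =
              algebraMap (v.adicCompletion ℚ) (AlgebraicClosure (v.adicCompletion ℚ)) (φ y)) →
          ∀ (ι : AlgebraicClosure ℚ →ₐ[ℚ] AlgebraicClosure ℚ_[2]),
            (∀ z, closureEmb (K := ℚ) (v.adicCompletion ℚ) z = Φ (ι z)) →
          ∀ (e : ∀ k : ℕ, CyclotomicField (cycLevel 2 k ∅) ℚ →ₐ[ℚ] PadicAlgCl 2),
            (∀ k, e k (IsCyclotomicExtension.zeta (cycLevel 2 k ∅) ℚ (CyclotomicField (cycLevel 2 k ∅) ℚ)) = zeta 2 k) →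
          ∀ (τ : ∀ m : ℕ, ZMod (2 ^ m) → Field.absoluteGaloisGroup ℚ_[2]),
            (∀ (m : ℕ) (a : ZMod (2 ^ m)), IsUnit a → τ m a • zeta 2 m = zeta 2 m ^ a.val) →
          ∀ (ιC : (m : ℕ) → (CyclotomicField m ℚ →+* ℂ)),
          (∀ k : ℕ, ιC (cycLevel 2 k ∅) (IsCyclotomicExtension.zeta (cycLevel 2 k ∅) ℚ (CyclotomicField (cycLevel 2 k ∅) ℚ)) =
            Complex.exp (2 * Real.pi * Complex.I / (cycLevel 2 k ∅ : ℕ))) →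
          ∃ κK : ℝ, κK ≠ 0 ∧
          ∃ ΛK : ∀ (k : ℕ) (r : Finset (HeightOneSpectrum (𝓞 ℚ))),
              H1 (tateRep W 2) (cycSubgroup 2 k r) →ₗ[ℤ_[2]] ℚ_[2] ⊗[ℚ] CyclotomicField (cycLevel 2 k r) ℚ,
            ∀ (c d a : ℤ) (A : ℕ), 0 < A → Int.gcd c (6 * 2 * A) = 1 → Int.gcd d (6 * 2 * W.conductorNorm ℤ) = 1 →
              ∃ (z : ∀ (k : ℕ) (r : (cyclotomicLevelsRat 2 (badPlaces c d A (W.conductorNorm ℤ))).Ideals),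
                    H1 (tateRep W 2) ((cyclotomicLevelsRat 2 (badPlaces c d A (W.conductorNorm ℤ))).level k r.1))
                (x : ∀ (k : ℕ) (r : (cyclotomicLevelsRat 2 (badPlaces c d A (W.conductorNorm ℤ))).Ideals),
                    CyclotomicField (cycLevel 2 k r.1) ℚ),
                ZetaBody W 2 f ιC κK ΛK c d a A z x ∧
                ∃ u : ℚ, u ≠ 0 ∧
                (haveI := isIntegral_genFib_baseChange 2 ((integralModelInt W).map (Int.castRingHom ℤ_[2]))
                 ∀ (n : ℕ) (Q₀ : localPoints W ℚ_[2])
                  (hQv : WeierstrassCurve.Affine.Point.map (W' := W)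
                      (Φ : AlgebraicClosure ℚ_[2] →ₐ[ℚ] AlgebraicClosure (v.adicCompletion ℚ))
                      (show (W.baseChange (AlgebraicClosure ℚ_[2])).toAffine.Point from Q₀) ∈
                    localLayerPointsOfEmb κ (closureEmb (K := ℚ) (v.adicCompletion ℚ)) W n),
                  (toLoc ((genFibΩ_eq_baseChange ((integralModelInt W).map (Int.castRingHom ℤ_[2]))).trans
                    (baseChange_twoAdicModel W))).symm Q₀ ∈
                    kernel (Valued.v (R := PadicAlgCl 2)) (genFibΩ 2 ((integralModelInt W).map (Int.castRingHom ℤ_[2]))) →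
                  algebraMap ℚ_[2] (PadicAlgCl 2)
                      ((pair n (levelToLayerTwo W hκ (∅ : Set (HeightOneSpectrum (𝓞 ℚ))) n
                          (z (n + 2) (cyclotomicLevelsRat 2 (badPlaces c d A (W.conductorNorm ℤ))).idealOne))
                        ⟨_, hQv⟩ : ℤ_[2]) : ℚ_[2]) =
                    (u : PadicAlgCl 2) * (∑ b : (ZMod (2 ^ (n + 2)))ˣ, τ (n + 2) (b : ZMod (2 ^ (n + 2))) •
                      (ptLogΩ 2 ((integralModelInt W).map (Int.castRingHom ℤ_[2]))
                          ((toLoc ((genFibΩ_eq_baseChange ((integralModelInt W).map (Int.castRingHom ℤ_[2]))).trans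
                            (baseChange_twoAdicModel W))).symm Q₀) *
                        e (n + 2) (x (n + 2) (cyclotomicLevelsRat 2 (badPlaces c d A (W.conductorNorm ℤ))).idealOne)) :
                      PadicAlgCl 2)) := by
  intro v hv W _ _ hcm hr hss ha κ γ hκ hγ hvar _ f hf ϖ hϖ Lplus Lminus hPol _ _ _ pair hP1 hP2 hP3 Φ φ hΦφ ι hι e he τ hτ ιC hιC
  obtain ⟨κK, hκK, ΛK, hK⟩ :=
    hKZ v hv W hcm hr hss ha κ γ hκ hγ hvar f hf ϖ hϖ Lplus Lminus hPol pair hP1 hP2 hP3 Φ φ hΦφ ι hι e he τ hτ ιC hιC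
  refine ⟨κK, hκK, ΛK, fun c d a A hA hc hd ↦ ?_⟩
  obtain ⟨z, x, hbody, hADJ⟩ := hK c d a A hA hc hd
  refine ⟨z, x, hbody, 1, one_ne_zero, fun n Q₀ hQv hk ↦ ?_⟩
  rw [hADJ n Q₀ hQv hk, Rat.cast_one, one_mul]

end Summit.BirchSwinnertonDyer.BirchSwinnertonDyer.Theorems.SignedKatoOffTwo.KatoBK
end
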